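import Literature.NumberTheory.Transcendental.KZProductIdeal
import Literature.NumberTheory.Transcendental.KZRegCalculus
import Literature.NumberTheory.Transcendental.KZSemialgebraicComplex
import Literature.NumberTheory.Transcendental.KZFibredRelations

/-!
# Crux stmt-KontsevichZagierPeriods-0540 (`LiouvilleUnfolding.AyoubPiCancellation` ≡ `KZ.PiCancellation`),
# line `Sketch` (idea `moving-segment-wronskian`): stub `stub_stripWeight`

Support file (`--supports` stmt-KontsevichZagierPeriods-0540) of the line skeleton, registered stub
`stub_stripWeight` (S). The STRIP WEIGHT of an interior strip `-1 < a < b < 1` (`a b` rational),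

  `w_{a,b}(t) = 𝟙_{(a,b)}(t) · 1 / (2√(1 − t²))`,

is an admissible weight for the master theorem `BetaCancellationLine.weightDescent`
(`Theorems/TerasomaMultiplicationBetaCancellationWeightDescent.lean`):

* (i) as a function of the single coordinate `x 0` of `ℝ¹` it is `ℚ`-semialgebraic on all of `ℝ¹`:
  on the `ℚ`-semialgebraic slab `A = {x | a < x 0 < b} = KZ.paramSlab 0 a b`
  (`KZ.isSemialgebraic_paramSlab`) it is the quotient `1 / (2√(1 − (x 0)²))` of
  `ℚ`-semialgebraic functions with non-vanishing denominator (`1 − (x 0)² > 0` there;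
  Bochnak–Coste–Roy Prop. 2.2.6: products, square roots and inverses of real semialgebraic functions
  are semialgebraic), and it is extended by zero off `A` (`IsSemialgebraicFunOn.indicator`);
* (ii) it is bounded: for `t ∈ (a, b)` one has `t² ≤ max (a²) (b²) < 1`, so
  `0 ≤ w_{a,b}(t) ≤ 1 / (2√(1 − max (a²) (b²)))`, and `w_{a,b} = 0` off `(a, b)`.

No definitions; namespace of the line skeleton. References: J. Bochnak, M. Coste, M.-F. Roy,
*Real Algebraic Geometry* (1998), §2.2, Prop. 2.2.6; M. Kontsevich, D. Zagier, *Periods* (2001), §1.1.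
-/

noncomputable section

-- `Summit.KontsevichZagierPeriods.KontsevichZagierPeriods.…` is the tree's mandated layout (single-conjunct summit).
set_option linter.dupNamespace false

namespace Summit.KontsevichZagierPeriods.KontsevichZagierPeriods.AyoubPiCancellationLine

open Set MeasureTheory
open Literature.NumberTheory.Transcendental
open Literature.NumberTheory.Transcendental.KZ
open Literature.ModelTheory.ExponentialFields (IsSemialgebraic isSemialgebraic_univ)
open MvPolynomial (X)

-- adapted from Summits/KontsevichZagierPeriods/KontsevichZagierPeriods/Theorems/TerasomaMultiplicationBetaCancellationStubWeightSemialgebraic.lean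
-- (atoms by `isSemialgebraicFunOn_aeval` + dot-chain `.sqrt_holds` / `.mul_holds` / `.div` + `congr`)

/-! ## Elementary inequalities on an interior strip -/

/-- On an interior slab `-1 < a < x 0 < b < 1` the radicand `1 - (x 0)²` is positive. [folklore] -/
theorem stripWeight_radicand_pos {a b : ℚ} (ha : -1 < a) (hb : b < 1) {t : ℝ}
    (hat : (a : ℝ) < t) (htb : t < (b : ℝ)) : 0 < 1 - t ^ 2 := by
  have ha' : (-1 : ℝ) < (a : ℝ) := by exact_mod_cast ha
  have hb' : ((b : ℚ) : ℝ) < 1 := by exact_mod_cast hb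
  nlinarith

/-- For `t` in an interior strip `(a, b)`, `-1 < a < b < 1`, one has `t² ≤ max (a²) (b²)`.
[folklore] -/
theorem stripWeight_sq_le_max {a b : ℚ} {t : ℝ} (hat : (a : ℝ) < t) (htb : t < (b : ℝ)) :
    t ^ 2 ≤ max ((a : ℝ) ^ 2) ((b : ℝ) ^ 2) := by
  rcases le_or_gt 0 t with ht | ht
  · exact le_trans (by nlinarith) (le_max_right _ _)
  · exact le_trans (by nlinarith) (le_max_left _ _)

/-- For an interior strip, `max (a²) (b²) < 1`. [folklore] -/
theorem stripWeight_max_lt_one {a b : ℚ} (ha : -1 < a) (hab : a < b) (hb : b < 1) :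
    max ((a : ℝ) ^ 2) ((b : ℝ) ^ 2) < 1 := by
  have ha' : (-1 : ℝ) < (a : ℝ) := by exact_mod_cast ha
  have hb' : ((b : ℚ) : ℝ) < 1 := by exact_mod_cast hb
  have hab' : ((a : ℚ) : ℝ) < b := by exact_mod_cast hab
  refine max_lt ?_ ?_ <;> nlinarith

/-! ## (i) Semialgebraicity -/

/-- On the slab `KZ.paramSlab 0 a b = {a < x 0 < b}` of an interior strip the profile
`x ↦ 1 / (2√(1 - (x 0)²))` is `ℚ`-semialgebraic: a quotient of real semialgebraic functions with
non-vanishing denominator (Bochnak–Coste–Roy Prop. 2.2.6). [folklore] -/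
theorem stripWeight_isSemialgebraicFunOn_slab {a b : ℚ} (ha : -1 < a) (hb : b < 1) :
    IsSemialgebraicFunOn ℚ (paramSlab 0 a b) (fun x => 1 / (2 * Real.sqrt (1 - x 0 ^ 2))) := by
  have hA : IsSemialgebraic ℚ (paramSlab 0 a b) := isSemialgebraic_paramSlab 0 a b
  have hnum : IsSemialgebraicFunOn ℚ (paramSlab 0 a b) (fun _ => (1 : ℝ)) :=
    isSemialgebraicFunOn_natCast hA 1 |>.congr fun x _ => by simp
  have hsqrt : IsSemialgebraicFunOn ℚ (paramSlab 0 a b) (fun x => Real.sqrt (1 - x 0 ^ 2)) :=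
    (IsSemialgebraicFunOn.sqrt_holds (isSemialgebraicFunOn_aeval hA
      (1 - X 0 ^ 2 : MvPolynomial (Fin 1) ℚ))).congr fun x _ => by simp
  have hden : IsSemialgebraicFunOn ℚ (paramSlab 0 a b) (fun x => 2 * Real.sqrt (1 - x 0 ^ 2)) :=
    (IsSemialgebraicFunOn.mul_holds (isSemialgebraicFunOn_natCast hA 2) hsqrt).congr
      fun x _ => by simp
  refine IsSemialgebraicFunOn.div hnum hden fun x hx => ?_
  rw [mem_paramSlab] at hx
  have hpos : 0 < 1 - x 0 ^ 2 := stripWeight_radicand_pos ha hb hx.1 hx.2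
  exact mul_ne_zero two_ne_zero (Real.sqrt_pos.mpr hpos).ne'

/-- The strip weight, read on `ℝ¹` through the coordinate `x 0`, is the extension by zero off the
slab `KZ.paramSlab 0 a b = {a < x 0 < b}` of the profile `1 / (2√(1 - (x 0)²))`. [folklore] -/
theorem stripWeight_indicator_apply (a b : ℚ) (x : Fin 1 → ℝ) :
    (Set.Ioo (a : ℝ) b).indicator (fun t => 1 / (2 * Real.sqrt (1 - t ^ 2))) (x 0) =
      (paramSlab 0 a b).indicator (fun x => 1 / (2 * Real.sqrt (1 - x 0 ^ 2))) x := by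
  by_cases hx : (a : ℝ) < x 0 ∧ x 0 < b
  · rw [indicator_of_mem (show x 0 ∈ Set.Ioo (a : ℝ) b from hx),
      indicator_of_mem (show x ∈ paramSlab 0 a b from hx)]
  · rw [indicator_of_notMem (show x 0 ∉ Set.Ioo (a : ℝ) b from hx),
      indicator_of_notMem (show x ∉ paramSlab 0 a b from hx)]

/-- **(i)** The strip weight `w_{a,b}(x 0) = 𝟙_{(a,b)}(x 0) / (2√(1 − (x 0)²))` of an interior
strip is `ℚ`-semialgebraic on all of `ℝ¹` (extension by zero of a semialgebraic function off a
semialgebraic set). [folklore] -/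
theorem stripWeight_isSemialgebraicFunOn {a b : ℚ} (ha : -1 < a) (hb : b < 1) :
    IsSemialgebraicFunOn ℚ (Set.univ : Set (Fin 1 → ℝ))
      (fun x => (Set.Ioo (a : ℝ) b).indicator (fun t => 1 / (2 * Real.sqrt (1 - t ^ 2))) (x 0)) := by
  have h : IsSemialgebraicFunOn ℚ (Set.univ : Set (Fin 1 → ℝ))
      ((paramSlab 0 a b).indicator (fun x => 1 / (2 * Real.sqrt (1 - x 0 ^ 2)))) :=
    IsSemialgebraicFunOn.indicator isSemialgebraic_univ (isSemialgebraic_paramSlab 0 a b)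
      ((stripWeight_isSemialgebraicFunOn_slab ha hb).mono inter_subset_right
        (isSemialgebraic_univ.inter (isSemialgebraic_paramSlab 0 a b)))
  exact h.congr fun x _ => (stripWeight_indicator_apply a b x).symm

/-! ## (ii) Boundedness -/

/-- **(ii)** The strip weight of an interior strip is bounded: for `t ∈ (a, b)`,
`0 ≤ 1 / (2√(1 − t²)) ≤ 1 / (2√(1 − max (a²) (b²)))`, and it vanishes off `(a, b)`. [folklore] -/
theorem stripWeight_abs_le {a b : ℚ} (ha : -1 < a) (hab : a < b) (hb : b < 1) (t : ℝ) :
    |(Set.Ioo (a : ℝ) b).indicator (fun t => 1 / (2 * Real.sqrt (1 - t ^ 2))) t| ≤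
      1 / (2 * Real.sqrt (1 - max ((a : ℝ) ^ 2) ((b : ℝ) ^ 2))) := by
  have hM : 0 < 1 - max ((a : ℝ) ^ 2) ((b : ℝ) ^ 2) := sub_pos.mpr (stripWeight_max_lt_one ha hab hb)
  have hsM : 0 < Real.sqrt (1 - max ((a : ℝ) ^ 2) ((b : ℝ) ^ 2)) := Real.sqrt_pos.mpr hM
  by_cases ht : t ∈ Set.Ioo (a : ℝ) b
  · rw [indicator_of_mem ht]
    have hle : 1 - max ((a : ℝ) ^ 2) ((b : ℝ) ^ 2) ≤ 1 - t ^ 2 :=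
      sub_le_sub_left (stripWeight_sq_le_max ht.1 ht.2) 1
    have hsle : Real.sqrt (1 - max ((a : ℝ) ^ 2) ((b : ℝ) ^ 2)) ≤ Real.sqrt (1 - t ^ 2) :=
      Real.sqrt_le_sqrt hle
    rw [abs_of_nonneg (by positivity)]
    exact one_div_le_one_div_of_le (by positivity) (by linarith)
  · rw [indicator_of_notMem ht, abs_zero]
    positivity

/-! ## The stub -/

/-- STUB `stub_stripWeight` (S) of the line `Sketch`: the strip weight
`w_{a,b}(x) = 𝟙_{(a,b)}(x) / (2√(1 − x²))` of an interior strip `-1 < a < b < 1` is an admissible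
weight for `BetaCancellationLine.weightDescent`: `ℚ`-semialgebraic as a function of `x 0` on `ℝ¹`,
and bounded. [folklore] -/
theorem stub_stripWeight : ∀ (a b : ℚ), -1 < a → a < b → b < 1 →
    IsSemialgebraicFunOn ℚ (Set.univ : Set (Fin 1 → ℝ))
        (fun x => (Set.Ioo (a : ℝ) b).indicator (fun t => 1 / (2 * Real.sqrt (1 - t ^ 2))) (x 0)) ∧
      ∃ C : ℝ, ∀ t : ℝ, |(Set.Ioo (a : ℝ) b).indicator (fun t => 1 / (2 * Real.sqrt (1 - t ^ 2))) t| ≤ C :=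
  fun _ _ ha hab hb =>
    ⟨stripWeight_isSemialgebraicFunOn ha hb, _, stripWeight_abs_le ha hab hb⟩

end Summit.KontsevichZagierPeriods.KontsevichZagierPeriods.AyoubPiCancellationLine
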